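import Literature.MathematicalPhysics.QuantumFieldTheory.Balaban1983to89.T4WeightBudget

/-!
# `Balaban1983to89.T4IndicatorShell` — node U5b/U5a of the uniqueness spine, design row T4-U5b.E2 "THE INDICATOR
SHELL": why a term-wise order of two runs' characteristic functions is impossible, the telescoped COMMON REFINEMENT
of a term into its core and its shell pieces, the domination of the shell pieces by single-run threshold-shell events
under sup-closeness of the backgrounds, and the plug "bad weight `W ↦ W + W^sh`" into `T4WeightBudget.RelWeightBound` /
`cauchy_of_relWeightBound` (cell `pub-balaban`, T4-DAG v4 §5 row T4-U5b.E2; kernel bookkeeping, Mathlib +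
`T4WeightBudget` only; companion record `t4/T4-EST-U5bE2.md`)

HONEST FRAMING (cell `pub-balaban`, T4-DAG PAGE 1).  The cell's T4 target is the existence AND uniqueness of the
continuum limit of Bałaban's unit-scale averaged loop expectations on a finite torus — a constructive-QFT statement
strictly beyond ultraviolet stability ([Balaban1989LargeFieldII] Thm 1 p. 355); it is NOT the Yang–Mills mass gap and
NOT the Clay problem.  NOTHING of the run-A/run-B comparison is printed: the manuscripts construct ONE run.  This module
is the KERNEL part of ONE design row (T4-U5b.E2) born from the cell-internal hazard G-pv07-4 (unit `b2b-balaban-pv07`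
gen 5, cross-read of `T4RecentScale`): `T4RecentScale.density_sandwich` pairs the terms of the two runs factor by factor
and needs every characteristic-function factor to be the IDENTICAL `{0,1}`-function of the common driving field in both
runs (`factorSandwich_of_eq`, `hoff`), but the BACKGROUND-MEDIATED small-field functions — [Balaban1988Convergent]
(2.17) p. 257, testing the run's own minimal configuration (2.16) on the run's own fine lattice (spacing `η` in run A,
`η/L` in run B) — take different VALUES on a threshold shell even when node U5a has synchronised every threshold
NUMBER (cell record `t4/T4-XREAD-U5X15.md` V3: "SETS differ across spacings by a U1a threshold shell").  Value = the
design decision made kernel-precise: (§1) a term-wise pointwise ORDER of the two runs' indicator products across a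
partition of unity forces EQUALITY, so the "offset-synchronised / monotone thresholds" design cannot be term-wise and
some unpaired shell mass is unavoidable whenever the two runs keep their own classifiers; (§2) the exact algebraic
COMMON-REFINEMENT identity `∏ᵢ pᵢ = ∏ᵢ pᵢqᵢ + Σᵢ (∏_{i'<i} p_{i'}q_{i'})·pᵢ(1 − qᵢ)·∏_{i'>i} p_{i'}` (one shell piece per
slot, not `2ⁿ` pieces); (§3) under sup-closeness `|u^A − u^B| ≤ Δ` of the tested background variables the mismatch
factors are dominated by SINGLE-RUN shell indicators `1[θ − Δ ≤ u^A < θ]` / `1[θ ≤ u^A < θ + Δ]` (and the one-integral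
monotone device of X-15 V3, `χ_{θ−Δ}(u^A) ≤ χ_θ(u^B) ≤ χ_{θ+Δ}(u^A)`, whose slack is again a single-run shell); (§4) the
typed OUTPUT SHAPE `ShellWeightBound` the new cell input "NE7c" must deliver (the relative weight of the shell pieces,
IN EACH RUN SEPARATELY, is summable over the number of steps) and the kernel-checked plug: an NE7b-output
`RelWeightBound … W` plus an NE7c-output `ShellWeightBound … Wsh` plus the good-class sandwich ON THE CORE PIECES give
`RelWeightBound` for the refined term families with weights `W + Wsh` and hence — verbatim through
`T4WeightBudget.cauchy_of_relWeightBound` — matching modulo constants with remainders `hybridDelta vol δ (W + Wsh)`, the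
Cauchy property and uniform convergence of the generating functions, for the SAME partition functions (the refinement
does not change any sum, `sum_refT_refA`).  NOT summit progress, NOT a proof of NE7c or NE7b, NOT a statement about
Bałaban's densities: every `def … : Prop` below is a hypothesis SHAPE; every theorem is finite-sum algebra or elementary
real analysis ([folklore]).

CITATION HEADER (lean-in-tree rule 2026-08-18).  This seat (`b2b-balaban-pv07` gen 6) read the RENDERS
`b2b-balaban-ref1/pages/1988-cmp119-convergent-renormalization/1988-cmp119-convergent-renormalization-p015-x2.png`
(journal p. 257 of T. Bałaban, *Convergent renormalization expansions for lattice gauge theories*, Commun. Math. Phys.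
**119** (1988) 243–285 [Balaban1988Convergent], cell paper B14; PDF page = journal page − 242),
`…/1989-cmp122-large-field-I/1989-cmp122-large-field-I-p007-x2.png` and `-p019-x2.png` (journal pp. 181, 193 of T. Bałaban,
*Large field renormalization. I. The basic step of the ℝ operation*, Commun. Math. Phys. **122** (1989) 175–202
[Balaban1989LargeFieldI], cell paper B15; PDF page = journal page − 174) and
`…/1987-cmp109-rg-I-small-field/1987-cmp109-rg-I-small-field-p016-x2.png` (journal p. 264 of T. Bałaban, *Renormalization
group approach to lattice gauge field theories. I*, Commun. Math. Phys. **109** (1987) 249–301 [Balaban1987RG1], cell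
paper B12; PDF page = journal page − 248) as images, and quotes VERBATIM:
* B14 p. 257: *"U_{k,□}(V_k) = U(𝐁_k(□^{∼4}), M˙(Q_k^{s*}V_k)) , (2.16)"*; *"χ_k(Ω_k) = ∏_{□⊂Ω_k} χ({sup_{p⊂□∼} |U_{k,□}(V_k,
  ∂p) − 1| < ε_kη²}) , (2.17) where the cubes □ belong to the partition of the lattice T_η into cubes of the size LM₂R_k.
  This partition is compatible with all other partitions of this lattice."*; *"ρ_k(V_k) = Σ_{{Ω_j},{Λ_j}} χ_k(Ω_k)T_k({Ω_j},
  {Λ_j}) exp A_k(1/g_k², U_k) , (2.18) where the summation is over the admissible sequences of domains."*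
* B15 p. 181: *"χ_k^{(0)} = χ({|U^{(0)}_{k,Z}(∂p) − 1| < (1 − β½)ε_h(L^{k−h}η)² for p ∈ Ω_h∖Ω_{h+1}}). (1.22)"*; *"The
  restrictions in the function (1.22) imply that the characteristic functions (1.3) for j = h and □ ⊂ (Ω^∼_{h+1})ᶜ∖Z_h are
  equal to 1."*; *"for these we change the regularity conditions by a factor, which is a power of some number, the power
  being proportional to a number of overlapping regions."* (the printed threshold LADDERS are deliberately non-sharp).
* B15 p. 193: *"On the other hand, for any extension we have |∂U_{k,Z} − 1| ≥ 2ε_kη², hence 2ε_k < O(1)B₃M²ε, and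
  |V_k(∂p′) − 1| > (O(1)B₃M²)^{−1}ε_k for some p′ ⊂ Z∩Λᶜ. This condition is enough to get the exponential small factor,
  estimating in the usual way the Wilson action. Thus 1 − χ_{k,Λ} is a large field function, and we exclude from Z the
  components with this function."* (THE PRINTED MECHANISM by which a region where a background-mediated regularity
  condition FAILS carries the large-field small factor — the template for bounding a threshold shell as a large-field
  event at a lowered threshold, X-15 V3); and *"All the above transformations preserve the k^{th} density ρ_k, they change
  only the representation of this density."*, *"The equality sign is replaced by the equivalence sign, the equivalence
  means that both sides have equal integrals over the space of fields V_k."* (the expansion is an identity: the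
  integrated generating functional does not depend on the thresholds of the procedure).
* B12 p. 264: *"Now we describe the most important expressions in (1.3), (1.6), the β-functions β_{j+1}(g_j). They are
  determined by the functions 𝐄^{(j+1)}(g_j, U_{j+1}) in (1.6)."*, followed by the definitions (1.20) (vacuum polarization
  tensor `Π^{ab}_{j+1,μν}(g_j, x, x′) = (δ²/δB^a_μ(x)δB^b_ν(x′) 𝐄^{(j+1)})(g_j, 0)`) and (1.22) (`β_{j+1}(g_j) = −(∂²/∂p₁∂p₂
  Π̃_{j+1,12})(g_j, 0)`).
The manuscripts are quoted for CONTEXT and SHAPE only; no disputed estimate of theirs is used anywhere below, and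
nothing printed is asserted.  The printed MODEL of a weight bound for an unmatched class is King's (3.10)–(3.11)
[King1986] (as in `T4WeightBudget.RelWeightBound`).

THE ROW SERVED (T4-DAG v4 §5, `t4/T4-DAG.md` sha256[:16] 72d96d27eb70a273, verbatim through the size column):
"T4-U5b.E2° | U5b/U5a | EST (design) | (v4) THE INDICATOR SHELL (hazard G-pv07-4, pv07-g5): `T4RecentScale.density_sandwich`
needs the indicator factors IDENTICAL in both runs, but background-mediated indicators (small-field characteristic
functions χ evaluated on the run-dependent backgrounds U^A_k vs U^B_{k+1}) differ on a THRESHOLD SHELL; deliver the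
hypothesis U5.E carries under ONE of two designs and its cost — (i) common refinement χ^Aχ^B with the mixed pieces
χ^A(1−χ^B), (1−χ^A)χ^B sent to the BAD class under a SHELL-WEIGHT bound (the weight of «some plaquette variable within
δ_j of a threshold at a recent scale» — a NEW NE7b-type input «NE7c», NOT PRINTED; count it iff chosen), (ii) the X-15 V3
monotone / OFFSET-SYNCHRONISED thresholds (choose run B's thresholds shifted by the `BackgroundsCloseU` distance so that
χ^A ≤ χ^B pointwise, then the reverse sandwich with roles swapped — a U5a design cost: thresholds are part of the
synchronised data); state which is cheaper and what each does to U5a/(1.6) | `T4RecentScale`, `T4Matching`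
(BackgroundsCloseU), `t4/T4-XREAD-U5X15.md` V3; B12 (0.19), B15 (1.2)ff | — | M".  DECISION (record `t4/T4-EST-U5bE2.md`):
design (i), typed here; design (ii) taken literally is excluded term-wise by §1 and reduces either to (i) (its slack is a
single-run shell, §3) or to the COMMON-CLASSIFIER variant (both runs classify with the same functional of the common
field — no shell at all, but run B then runs a non-printed procedure), recorded in the companion file with its cost;
B12 (1.6) (the β-functions, node U2) is untouched by either design: [Balaban1987RG1] p. 264 *"the β-functions
β_{j+1}(g_j). They are determined by the functions 𝐄^{(j+1)}(g_j, U_{j+1}) in (1.6)."* through the vacuum polarization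
tensor (1.20) and (1.22) — a definition with no characteristic function in it (cell record `t4/T4-XREAD-U5a.md` §4 (iv)),
so re-booking or re-classifying indicator factors of the large-field expansion never feeds the coupling recursion.

## What is typed and what is proved

§1 [folklore] `eq_of_termwise_le_of_sum_eq`: on a finite index set, `I^A_τ ≤ I^B_τ` for all `τ` and `Σ_τ I^A_τ = Σ_τ I^B_τ`
force `I^A_τ = I^B_τ` for all `τ` — applied to the two runs' indicator products over ONE partition of unity at a fixed
driving field (`Σ_τ = 1` in both runs), a term-wise pointwise order is equality: design (ii) cannot be term-wise.
§2 [folklore] `shellPiece`, `prod_eq_core_add_sum_shell` (the telescoped refinement identity over `Finset.range n`, valid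
for arbitrary reals), `shellPiece_nonneg`, `shellPiece_le` (`≤ pᵢ(1 − qᵢ)` for factors in `[0,1]`), `core_le_prod`.
§3 [folklore] real-valued threshold indicators `smallInd u θ = 1[u < θ]`, `largeInd u θ = 1[θ ≤ u]`, the shells
`shellBelow u θ Δ = 1[θ − Δ ≤ u < θ]`, `shellAbove u θ Δ = 1[θ ≤ u < θ + Δ]`; `smallInd_add_largeInd` (partition of unity
per slot); under `|u^A − u^B| ≤ Δ`: `smallInd_mul_one_sub_le` (`χ_θ(u^A)(1 − χ_θ(u^B)) ≤ 1[θ − Δ ≤ u^A < θ]`),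
`largeInd_mul_one_sub_le` (`ζ_θ(u^A)(1 − ζ_θ(u^B)) ≤ 1[θ ≤ u^A < θ + Δ]`), the monotone device `smallInd_offset_mono_left/right`
(`χ_{θ−Δ}(u^A) ≤ χ_θ(u^B) ≤ χ_{θ+Δ}(u^A)`) and its slack `smallInd_offset_sub` (`χ_{θ+Δ}(u) − χ_θ(u) = 1[θ ≤ u < θ + Δ]`).
§4 [folklore] the OUTPUT SHAPE `ShellWeightBound l₀ T A B shA shB Wsh` (NE7c, NOT PRINTED, NOT asserted: the shell parts
`shA ≤ A`, `shB ≤ B` of the term weights have relative total weight `≤ Wsh K` in each run separately, `Σ_K Wsh K < ∞`);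
the refined families on the index type `ι ⊕ ι` (`refT`, `refVal`, `refBad`: core pieces `A − shA` on the left copy,
shell pieces `shA` on the right copy, the bad class = old bad cores ∪ all shells); `sum_refT_refVal` (the refinement
preserves every sum); `relWeightBound_ref` (`RelWeightBound … W` ∧ `ShellWeightBound … Wsh` ∧ `W + Wsh < 1` ⇒
`RelWeightBound` for the refined families with `W + Wsh`); `good_ref` (a sandwich of the CORE pieces on the old good
class is the good-class sandwich of the refined families); `cauchy_of_relWeightBound_shell` (the conclusions of
`T4WeightBudget.cauchy_of_relWeightBound` with `W` replaced by `W + Wsh`, for the same `Z`).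

Deliberately NOT here: which factors of a (2.18)/(1.104)-term are background-mediated indicators (the census is
`t4/T4-XREAD-U5X15.md` §1, kinds A1–A3, A6, A7, B4, B5, B11, B15); the closeness input `|u^A − u^B| ≤ Δ` itself (an
NE3-species statement in the sup-form at the scale of each indicator — nodes U1b/U3, `T4EtaRateMin`, `T4OutputRate`;
NOT PRINTED: B11 prints η-uniform regularity only, `t4/T4-XREAD-U1b.md`); the shell-weight estimate NE7c (beyond kernel
reach, like NE7b: its printed TEMPLATE is the p. 193 mechanism at the lowered threshold `(1 − ρ)θ`, its count the
survival arithmetic of `T4WeightBudget` §3 — companion record §2); the common-classifier alternative (companion record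
§3); anything about (1.6)/node U2 (untouched, see above).
-/

open Finset _root_.Filter _root_.Topology

namespace Literature.MathematicalPhysics.QuantumFieldTheory.Balaban1983to89.T4IndicatorShell

open T4HybridMatching T4CauchySum T4WeightBudget

/-! ## §1 The conservation obstruction: no strict term-wise order across two partitions of unity -/

/-- **No term-wise order without equality.**  If on a finite index set `I^A_τ ≤ I^B_τ` term by term and the totals
agree, then `I^A_τ = I^B_τ` for every term.  Applied at a fixed driving field `v` to the indicator products of the two
runs over ONE partition of unity (`Σ_τ I^A_τ(v) = 1 = Σ_τ I^B_τ(v)`): the "offset thresholds so that `χ^A ≤ χ^B`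
pointwise" design cannot hold term-wise unless the two runs' indicator products coincide — some unpaired (shell) mass
is unavoidable whenever the runs keep their own background-mediated classifiers. [folklore] -/
theorem eq_of_termwise_le_of_sum_eq {ι : Type*} (T : Finset ι) {IA IB : ι → ℝ} (hle : ∀ τ ∈ T, IA τ ≤ IB τ)
    (hsum : ∑ τ ∈ T, IA τ = ∑ τ ∈ T, IB τ) : ∀ τ ∈ T, IA τ = IB τ :=
  (Finset.sum_eq_sum_iff_of_le hle).1 hsum

/-- The partition-of-unity form: two families summing to `1` that are ordered term-wise are equal term-wise.
[folklore] -/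
theorem eq_of_termwise_le_of_partition {ι : Type*} (T : Finset ι) {IA IB : ι → ℝ} (hle : ∀ τ ∈ T, IA τ ≤ IB τ)
    (hA : ∑ τ ∈ T, IA τ = 1) (hB : ∑ τ ∈ T, IB τ = 1) : ∀ τ ∈ T, IA τ = IB τ :=
  eq_of_termwise_le_of_sum_eq T hle (hA.trans hB.symm)

/-! ## §2 The telescoped common refinement of a product of indicator factors -/

/-- THE `i`-TH SHELL PIECE of the refinement of `∏_{i<n} pᵢ` against a second family `q`: the slots before `i` carry the
common refinement `p_{i'}q_{i'}`, slot `i` carries the mismatch `pᵢ(1 − qᵢ)`, the slots after `i` carry `p_{i'}` alone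
("first mismatch at slot `i`"). [folklore] -/
def shellPiece (p q : ℕ → ℝ) (n i : ℕ) : ℝ :=
  (∏ i' ∈ range i, p i' * q i') * (p i * (1 - q i)) * ∏ i' ∈ Ico (i + 1) n, p i'

/-- **THE COMMON-REFINEMENT IDENTITY** (telescoped; an algebraic identity for arbitrary reals):
`∏_{i<n} pᵢ = ∏_{i<n} pᵢqᵢ + Σ_{i<n} shellPiece p q n i` — ONE shell piece per slot.  With `p` = run A's indicator
factors of a term and `q` = run B's, the first summand is the CORE (the identical factor `∏ χ^Aχ^B` once the same is
done in run B) and the shell pieces are the new bad-class terms of design (i). [folklore] -/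
theorem prod_eq_core_add_sum_shell (p q : ℕ → ℝ) (n : ℕ) :
    ∏ i ∈ range n, p i = ∏ i ∈ range n, (p i * q i) + ∑ i ∈ range n, shellPiece p q n i := by
  induction n with
  | zero => simp
  | succ n ih =>
    have h1 : ∀ i ∈ range n, shellPiece p q (n + 1) i = shellPiece p q n i * p n := by
      intro i hi
      have hin : i + 1 ≤ n := Nat.succ_le_of_lt (mem_range.1 hi)
      simp only [shellPiece]
      rw [Finset.prod_Ico_succ_top hin]
      ring
    have h2 : shellPiece p q (n + 1) n = (∏ i' ∈ range n, p i' * q i') * (p n * (1 - q n)) := by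
      simp [shellPiece]
    rw [prod_range_succ, prod_range_succ, sum_range_succ, sum_congr rfl h1, h2, ← sum_mul, ih]
    ring

/-- Shell pieces of factors in `[0, 1]` are nonnegative. [folklore] -/
theorem shellPiece_nonneg {p q : ℕ → ℝ} {n : ℕ} (hp : ∀ i < n, 0 ≤ p i) (hq1 : ∀ i < n, q i ≤ 1)
    (hq : ∀ i < n, 0 ≤ q i) {i : ℕ} (hi : i < n) : 0 ≤ shellPiece p q n i := by
  unfold shellPiece
  refine mul_nonneg (mul_nonneg ?_ ?_) ?_
  · exact prod_nonneg fun i' hi' => mul_nonneg (hp i' ((mem_range.1 hi').trans hi)) (hq i' ((mem_range.1 hi').trans hi))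
  · exact mul_nonneg (hp i hi) (sub_nonneg.2 (hq1 i hi))
  · exact prod_nonneg fun i' hi' => hp i' (mem_Ico.1 hi').2

/-- A shell piece of factors in `[0, 1]` is at most its mismatch factor `pᵢ(1 − qᵢ)`. [folklore] -/
theorem shellPiece_le {p q : ℕ → ℝ} {n : ℕ} (hp : ∀ i < n, 0 ≤ p i) (hp1 : ∀ i < n, p i ≤ 1)
    (hq : ∀ i < n, 0 ≤ q i) (hq1 : ∀ i < n, q i ≤ 1) {i : ℕ} (hi : i < n) :
    shellPiece p q n i ≤ p i * (1 - q i) := by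
  unfold shellPiece
  have hmid : 0 ≤ p i * (1 - q i) := mul_nonneg (hp i hi) (sub_nonneg.2 (hq1 i hi))
  have hL : ∏ i' ∈ range i, p i' * q i' ≤ 1 := by
    refine prod_le_one (fun i' hi' => mul_nonneg (hp i' ((mem_range.1 hi').trans hi))
      (hq i' ((mem_range.1 hi').trans hi))) fun i' hi' => ?_
    have h' := (mem_range.1 hi').trans hi
    calc p i' * q i' ≤ 1 * 1 := mul_le_mul (hp1 i' h') (hq1 i' h') (hq i' h') zero_le_one
      _ = 1 := one_mul 1
  have hL0 : 0 ≤ ∏ i' ∈ range i, p i' * q i' :=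
    prod_nonneg fun i' hi' => mul_nonneg (hp i' ((mem_range.1 hi').trans hi)) (hq i' ((mem_range.1 hi').trans hi))
  have hR : ∏ i' ∈ Ico (i + 1) n, p i' ≤ 1 :=
    prod_le_one (fun i' hi' => hp i' (mem_Ico.1 hi').2) fun i' hi' => hp1 i' (mem_Ico.1 hi').2
  have hR0 : 0 ≤ ∏ i' ∈ Ico (i + 1) n, p i' := prod_nonneg fun i' hi' => hp i' (mem_Ico.1 hi').2
  calc (∏ i' ∈ range i, p i' * q i') * (p i * (1 - q i)) * ∏ i' ∈ Ico (i + 1) n, p i'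
      ≤ 1 * (p i * (1 - q i)) * 1 := by
        apply mul_le_mul (mul_le_mul_of_nonneg_right hL hmid) hR hR0
        exact mul_nonneg zero_le_one hmid
    _ = p i * (1 - q i) := by ring

/-- The core `∏ pᵢqᵢ` is at most the original product `∏ pᵢ` (factors in `[0, 1]`). [folklore] -/
theorem core_le_prod {p q : ℕ → ℝ} {n : ℕ} (hp : ∀ i < n, 0 ≤ p i) (hq : ∀ i < n, 0 ≤ q i)
    (hq1 : ∀ i < n, q i ≤ 1) : ∏ i ∈ range n, (p i * q i) ≤ ∏ i ∈ range n, p i := by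
  refine prod_le_prod (fun i hi => mul_nonneg (hp i (mem_range.1 hi)) (hq i (mem_range.1 hi))) fun i hi => ?_
  calc p i * q i ≤ p i * 1 := mul_le_mul_of_nonneg_left (hq1 i (mem_range.1 hi)) (hp i (mem_range.1 hi))
    _ = p i := mul_one _

/-- The sum of the shell pieces is the deficit `∏ pᵢ − ∏ pᵢqᵢ`, hence at most `∏ pᵢ` for factors in `[0, 1]`: the shell
part of a term never exceeds the term. [folklore] -/
theorem sum_shell_le_prod {p q : ℕ → ℝ} {n : ℕ} (hp : ∀ i < n, 0 ≤ p i) (hq : ∀ i < n, 0 ≤ q i) :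
    ∑ i ∈ range n, shellPiece p q n i ≤ ∏ i ∈ range n, p i := by
  have h := prod_eq_core_add_sum_shell p q n
  have hc : 0 ≤ ∏ i ∈ range n, (p i * q i) :=
    prod_nonneg fun i hi => mul_nonneg (hp i (mem_range.1 hi)) (hq i (mem_range.1 hi))
  linarith

/-! ## §3 Threshold indicators, shells, and domination under sup-closeness of the tested variables -/

/-- the small-field indicator `χ_θ(u) = 1[u < θ]` of a tested background variable `u` (e.g. `sup_{p⊂□∼}|U_{k,□}(V_k,∂p) − 1|`
of (2.17)) at threshold `θ` (e.g. `ε_kη²`), as a real number. [cite: Balaban1988Convergent, (2.17) p.257] -/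
noncomputable def smallInd (u θ : ℝ) : ℝ := if u < θ then 1 else 0

/-- the large-field indicator `ζ_θ(u) = 1 − χ_θ(u) = 1[θ ≤ u]`. [cite: Balaban1989LargeFieldI, (1.75) p.193] -/
noncomputable def largeInd (u θ : ℝ) : ℝ := if θ ≤ u then 1 else 0

/-- the shell BELOW the threshold, `1[θ − Δ ≤ u < θ]` (relative width `Δ/θ`). [folklore] -/
noncomputable def shellBelow (u θ Δ : ℝ) : ℝ := if θ - Δ ≤ u ∧ u < θ then 1 else 0

/-- the shell ABOVE the threshold, `1[θ ≤ u < θ + Δ]`. [folklore] -/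
noncomputable def shellAbove (u θ Δ : ℝ) : ℝ := if θ ≤ u ∧ u < θ + Δ then 1 else 0

/-- `χ_θ + ζ_θ = 1`: the per-slot decomposition of unity of [Balaban1989LargeFieldI] p. 193 *"unity 1 = χ_{k,Λ} +
(1 − χ_{k,Λ})"*. [folklore] -/
theorem smallInd_add_largeInd (u θ : ℝ) : smallInd u θ + largeInd u θ = 1 := by
  unfold smallInd largeInd
  by_cases h : u < θ
  · simp [h, not_le.2 h]
  · simp [h, not_lt.1 h]

/-- `0 ≤ χ_θ(u)`. [folklore] -/
theorem smallInd_nonneg (u θ : ℝ) : 0 ≤ smallInd u θ := by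
  unfold smallInd; split_ifs <;> norm_num

/-- `χ_θ(u) ≤ 1`. [folklore] -/
theorem smallInd_le_one (u θ : ℝ) : smallInd u θ ≤ 1 := by
  unfold smallInd; split_ifs <;> norm_num

/-- `0 ≤ ζ_θ(u)`. [folklore] -/
theorem largeInd_nonneg (u θ : ℝ) : 0 ≤ largeInd u θ := by
  unfold largeInd; split_ifs <;> norm_num

/-- `ζ_θ(u) ≤ 1`. [folklore] -/
theorem largeInd_le_one (u θ : ℝ) : largeInd u θ ≤ 1 := by
  unfold largeInd; split_ifs <;> norm_num

/-- shell indicators are nonnegative. [folklore] -/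
theorem shellBelow_nonneg (u θ Δ : ℝ) : 0 ≤ shellBelow u θ Δ := by
  unfold shellBelow; split_ifs <;> norm_num

/-- shell indicators are nonnegative. [folklore] -/
theorem shellAbove_nonneg (u θ Δ : ℝ) : 0 ≤ shellAbove u θ Δ := by
  unfold shellAbove; split_ifs <;> norm_num

/-- **SHELL DOMINATION, small-field slots.**  If the two runs' tested variables are `Δ`-close, the mismatch "small in
run A, not small in run B" at a common threshold lies in run A's OWN shell below the threshold:
`χ_θ(u^A)(1 − χ_θ(u^B)) ≤ 1[θ − Δ ≤ u^A < θ]` — a SINGLE-RUN event (no run-B object left). [folklore] -/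
theorem smallInd_mul_one_sub_le {uA uB θ Δ : ℝ} (h : |uA - uB| ≤ Δ) :
    smallInd uA θ * (1 - smallInd uB θ) ≤ shellBelow uA θ Δ := by
  have h' := abs_sub_le_iff.1 h
  unfold smallInd shellBelow
  by_cases hA : uA < θ
  · by_cases hB : uB < θ
    · simp only [hA, hB, if_true]; split_ifs <;> norm_num
    · have hs : θ - Δ ≤ uA ∧ uA < θ := ⟨by linarith [not_lt.1 hB, h'.2], hA⟩
      simp [hA, hB, hs]
  · simp only [hA, if_false, zero_mul]
    split_ifs <;> norm_num

/-- **SHELL DOMINATION, large-field slots.**  `ζ_θ(u^A)(1 − ζ_θ(u^B)) ≤ 1[θ ≤ u^A < θ + Δ]` under `Δ`-closeness: the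
mismatch of a large-field function lies in run A's own shell above the threshold (where run A's term already carries
the large-field function with threshold `θ`). [folklore] -/
theorem largeInd_mul_one_sub_le {uA uB θ Δ : ℝ} (h : |uA - uB| ≤ Δ) :
    largeInd uA θ * (1 - largeInd uB θ) ≤ shellAbove uA θ Δ := by
  have h' := abs_sub_le_iff.1 h
  unfold largeInd shellAbove
  by_cases hA : θ ≤ uA
  · by_cases hB : θ ≤ uB
    · simp only [hA, hB, if_true]; split_ifs <;> norm_num
    · have hs : θ ≤ uA ∧ uA < θ + Δ := ⟨hA, by linarith [not_le.1 hB, h'.1]⟩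
      simp [hA, hB, hs]
  · simp only [hA, if_false, zero_mul]
    split_ifs <;> norm_num

/-- The symmetric statements for run B's mismatch pieces follow by swapping the roles (`|u^B − u^A| ≤ Δ`). [folklore] -/
theorem abs_sub_comm_le {uA uB Δ : ℝ} (h : |uA - uB| ≤ Δ) : |uB - uA| ≤ Δ := by
  rwa [abs_sub_comm]

/-- THE ONE-INTEGRAL MONOTONE DEVICE of X-15 V3, left half: `χ_{θ−Δ}(u^A) ≤ χ_θ(u^B)` under `Δ`-closeness. [folklore] -/
theorem smallInd_offset_mono_left {uA uB θ Δ : ℝ} (h : |uA - uB| ≤ Δ) :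
    smallInd uA (θ - Δ) ≤ smallInd uB θ := by
  have h' := abs_sub_le_iff.1 h
  unfold smallInd
  by_cases hA : uA < θ - Δ
  · have hB : uB < θ := by linarith [h'.2]
    simp [hA, hB]
  · simp only [hA, if_false]
    split_ifs <;> norm_num

/-- … right half: `χ_θ(u^B) ≤ χ_{θ+Δ}(u^A)`. [folklore] -/
theorem smallInd_offset_mono_right {uA uB θ Δ : ℝ} (h : |uA - uB| ≤ Δ) :
    smallInd uB θ ≤ smallInd uA (θ + Δ) := by
  have h' := abs_sub_le_iff.1 h
  unfold smallInd
  by_cases hB : uB < θ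
  · have hA : uA < θ + Δ := by linarith [h'.1]
    simp [hA, hB]
  · simp only [hB, if_false]
    split_ifs <;> norm_num

/-- … and its SLACK is a single-run shell: `χ_{θ+Δ}(u) − χ_θ(u) = 1[θ ≤ u < θ + Δ]` for `0 ≤ Δ` — the monotone device
does not avoid the shell weight, it books it one-sidedly. [folklore] -/
theorem smallInd_offset_sub {u θ Δ : ℝ} (hΔ : 0 ≤ Δ) :
    smallInd u (θ + Δ) - smallInd u θ = shellAbove u θ Δ := by
  unfold smallInd shellAbove
  by_cases h1 : u < θ
  · have h2 : u < θ + Δ := by linarith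
    simp [h1, h2, not_le.2 h1]
  · by_cases h2 : u < θ + Δ
    · simp [h1, h2, not_lt.1 h1]
    · simp [h1, h2]

/-- POINTWISE CONSEQUENCE FOR A TERM (design (i) at one driving field): if run A's term density is `(∏_{i<n} χᵢ^A)·R`
with `R ≥ 0` and `{0,1}`-valued indicator slots, then its `i`-th shell piece against run B's indicators is at most the
term itself times the single-run shell indicator of slot `i`:
`shellPiece χ^A χ^B n i · R ≤ 1[θᵢ − Δᵢ ≤ uᵢ^A < θᵢ] · ((∏ χ^A)·R)` whenever slot `i` reads `χ_{θᵢ}(uᵢ^{A/B})` with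
`|uᵢ^A − uᵢ^B| ≤ Δᵢ`.  (So the total shell part of a term is at most the term times the NUMBER of its slots whose run-A
variable lies in its own shell — the event NE7c must weigh, companion record §2.) [folklore] -/
theorem shellPiece_mul_le_shell_mul_term {uA uB θ Δ : ℕ → ℝ} {n i : ℕ} (hi : i < n) {R : ℝ} (hR : 0 ≤ R)
    (hclose : |uA i - uB i| ≤ Δ i) :
    shellPiece (fun i' => smallInd (uA i') (θ i')) (fun i' => smallInd (uB i') (θ i')) n i * R ≤
      shellBelow (uA i) (θ i) (Δ i) * ((∏ i' ∈ range n, smallInd (uA i') (θ i')) * R) := by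
  -- abbreviations
  set p : ℕ → ℝ := fun i' => smallInd (uA i') (θ i') with hp
  set q : ℕ → ℝ := fun i' => smallInd (uB i') (θ i') with hq
  have hp0 : ∀ i', 0 ≤ p i' := fun i' => smallInd_nonneg _ _
  have hp1 : ∀ i', p i' ≤ 1 := fun i' => smallInd_le_one _ _
  have hq0 : ∀ i', 0 ≤ q i' := fun i' => smallInd_nonneg _ _
  have hq1 : ∀ i', q i' ≤ 1 := fun i' => smallInd_le_one _ _
  -- the indicator of slot i is idempotent: p i * p i = p i
  have hpp : p i * p i = p i := by
    simp only [hp, smallInd]; split_ifs <;> norm_num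
  -- split the full product at slot i
  have hsplit : ∏ i' ∈ range n, p i' = (∏ i' ∈ range i, p i') * p i * ∏ i' ∈ Ico (i + 1) n, p i' := by
    have h1 : range n = range (i + 1) ∪ Ico (i + 1) n := by
      rw [range_eq_Ico, range_eq_Ico, Finset.Ico_union_Ico_eq_Ico (Nat.zero_le _) (Nat.succ_le_of_lt hi)]
    rw [h1, prod_union, prod_range_succ]
    rw [range_eq_Ico]
    exact Finset.Ico_disjoint_Ico_consecutive 0 (i + 1) n
  -- bound the left block of the shell piece by the left block of the product
  have hL : ∏ i' ∈ range i, p i' * q i' ≤ ∏ i' ∈ range i, p i' :=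
    prod_le_prod (fun i' _ => mul_nonneg (hp0 i') (hq0 i')) fun i' _ => by
      calc p i' * q i' ≤ p i' * 1 := mul_le_mul_of_nonneg_left (hq1 i') (hp0 i')
        _ = p i' := mul_one _
  have hL0 : 0 ≤ ∏ i' ∈ range i, p i' * q i' := prod_nonneg fun i' _ => mul_nonneg (hp0 i') (hq0 i')
  have hR0 : 0 ≤ ∏ i' ∈ Ico (i + 1) n, p i' := prod_nonneg fun i' _ => hp0 i'
  -- the mismatch factor is dominated by the shell indicator, and p i (1 - q i) = p i * (p i (1 - q i))
  have hdom : p i * (1 - q i) ≤ shellBelow (uA i) (θ i) (Δ i) := smallInd_mul_one_sub_le hclose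
  have hmid0 : 0 ≤ p i * (1 - q i) := mul_nonneg (hp0 i) (sub_nonneg.2 (hq1 i))
  have hsh1 : shellBelow (uA i) (θ i) (Δ i) ≤ 1 := by
    unfold shellBelow; split_ifs <;> norm_num
  have hkey : p i * (1 - q i) ≤ shellBelow (uA i) (θ i) (Δ i) * p i := by
    have : p i * (1 - q i) = p i * (p i * (1 - q i)) := by rw [← mul_assoc, hpp]
    rw [this]
    calc p i * (p i * (1 - q i)) ≤ p i * shellBelow (uA i) (θ i) (Δ i) :=
          mul_le_mul_of_nonneg_left hdom (hp0 i)
      _ = shellBelow (uA i) (θ i) (Δ i) * p i := mul_comm _ _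
  have hPl0 : 0 ≤ ∏ i' ∈ range i, p i' := prod_nonneg fun i' _ => hp0 i'
  unfold shellPiece
  rw [hsplit]
  calc (∏ i' ∈ range i, p i' * q i') * (p i * (1 - q i)) * (∏ i' ∈ Ico (i + 1) n, p i') * R
      ≤ (∏ i' ∈ range i, p i') * (shellBelow (uA i) (θ i) (Δ i) * p i) * (∏ i' ∈ Ico (i + 1) n, p i') * R := by
        gcongr
    _ = shellBelow (uA i) (θ i) (Δ i) * ((∏ i' ∈ range i, p i') * p i * (∏ i' ∈ Ico (i + 1) n, p i') * R) := by
        ring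

/-! ## §4 The output shape NE7c must deliver, and the plug `W ↦ W + Wsh` into `RelWeightBound` -/

/-- NAMED HYPOTHESIS SHAPE `ShellWeightBound` (the cell's new input "NE7c" of design (i) in the OUTPUT SHAPE the kernel
consumes; NOT a printed statement, NOT asserted).  For every number of steps `K` and source strength `|t| ≤ l₀`, the term
weights `A K t τ`, `B K t τ` of the two runs (as in `T4WeightBudget.RelWeightBound`) have SHELL PARTS `shA K t τ`,
`shB K t τ` — the integrated sums of the shell pieces of §2 of the term's background-mediated indicator slots, dominated
via §3 by the term's own weight on the event "some tested variable of the term within `Δ` of its threshold" — with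
`0 ≤ sh ≤` the term weight, and the TOTAL shell part has relative weight at most `Wsh K` IN EACH RUN SEPARATELY, with
`Σ_K Wsh K < ∞`.  Printed TEMPLATE of the estimate (not of the statement): the large-field small factor carried by a
region where a regularity condition fails at a (lowered) threshold, [Balaban1989LargeFieldI] p. 193; its count is the
survival arithmetic of `T4WeightBudget` §3 with the small-factor exponent available at threshold `(1 − ρ)θ`.
[cite: Balaban1989LargeFieldI, p.193 (mechanism of 1 − χ_{k,Λ})] -/
structure ShellWeightBound {ι : Type*} (l₀ : ℝ) (T : ℕ → Finset ι) (A B shA shB : ℕ → ℝ → ι → ℝ)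
    (Wsh : ℕ → ℝ) : Prop where
  /-- the weight bounds are nonnegative -/
  nonneg : ∀ K, 0 ≤ Wsh K
  /-- … and summable over the number of steps -/
  summable : Summable Wsh
  /-- run A: shell parts are nonnegative -/
  sh_nonneg_left : ∀ K t, |t| ≤ l₀ → ∀ τ ∈ T K, 0 ≤ shA K t τ
  /-- run A: the shell part of a term never exceeds the term (`sum_shell_le_prod`) -/
  sh_le_left : ∀ K t, |t| ≤ l₀ → ∀ τ ∈ T K, shA K t τ ≤ A K t τ
  /-- run B: shell parts are nonnegative -/
  sh_nonneg_right : ∀ K t, |t| ≤ l₀ → ∀ τ ∈ T K, 0 ≤ shB K t τ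
  /-- run B: the shell part of a term never exceeds the term -/
  sh_le_right : ∀ K t, |t| ≤ l₀ → ∀ τ ∈ T K, shB K t τ ≤ B K t τ
  /-- run A: the total shell part has relative weight at most `Wsh K` -/
  left : ∀ K t, |t| ≤ l₀ → ∑ τ ∈ T K, shA K t τ ≤ Wsh K * ∑ τ ∈ T K, A K t τ
  /-- run B: the total shell part has relative weight at most `Wsh K` -/
  right : ∀ K t, |t| ≤ l₀ → ∑ τ ∈ T K, shB K t τ ≤ Wsh K * ∑ τ ∈ T K, B K t τ

section Plug

variable {ι : Type*} {l₀ vol : ℝ} {T : ℕ → Finset ι} {A B shA shB : ℕ → ℝ → ι → ℝ}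
  {Bad : ℕ → ℝ → Finset ι} {W Wsh δ : ℕ → ℝ}

/-- THE REFINED TERM FAMILY on the index type `ι ⊕ ι`: a left copy of every term (its CORE piece) and a right copy
(its SHELL part). [folklore] -/
def refT (T : ℕ → Finset ι) (K : ℕ) : Finset (ι ⊕ ι) := (T K).disjSum (T K)

/-- THE REFINED WEIGHTS: core `A − shA` on the left copy, shell `shA` on the right copy. [folklore] -/
def refVal (A shA : ℕ → ℝ → ι → ℝ) (K : ℕ) (t : ℝ) : ι ⊕ ι → ℝ :=
  Sum.elim (fun τ => A K t τ - shA K t τ) (fun τ => shA K t τ)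

/-- THE REFINED BAD CLASS: the cores of the old bad terms and ALL shell parts. [folklore] -/
def refBad (T : ℕ → Finset ι) (Bad : ℕ → ℝ → Finset ι) (K : ℕ) (t : ℝ) : Finset (ι ⊕ ι) :=
  (Bad K t).disjSum (T K)

/-- the left copy of a term carries its core `A − shA`. [folklore] -/
@[simp] theorem refVal_inl (K : ℕ) (t : ℝ) (τ : ι) : refVal A shA K t (Sum.inl τ) = A K t τ - shA K t τ := rfl

/-- the right copy of a term carries its shell part `shA`. [folklore] -/
@[simp] theorem refVal_inr (K : ℕ) (t : ℝ) (τ : ι) : refVal A shA K t (Sum.inr τ) = shA K t τ := rfl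

/-- **The refinement changes no sum**: `Σ_{refined terms} (refined weights) = Σ_{terms} (weights)` — the partition
functions compared by node U5 are the same numbers before and after the refinement (cf. [Balaban1989LargeFieldI] p. 193
*"they change only the representation of this density"*). [folklore] -/
theorem sum_refT_refVal (K : ℕ) (t : ℝ) :
    ∑ x ∈ refT T K, refVal A shA K t x = ∑ τ ∈ T K, A K t τ := by
  rw [refT, Finset.sum_disjSum]
  simp only [refVal_inl, refVal_inr, sum_sub_distrib]
  ring

/-- The refined weights are nonnegative when `0 ≤ sh ≤` weight. [folklore] -/
theorem refVal_nonneg {K : ℕ} {t : ℝ} (h0 : ∀ τ ∈ T K, 0 ≤ shA K t τ) (hle : ∀ τ ∈ T K, shA K t τ ≤ A K t τ) :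
    ∀ x ∈ refT T K, 0 ≤ refVal A shA K t x := by
  intro x hx
  rw [refT, Finset.mem_disjSum] at hx
  rcases hx with ⟨τ, hτ, rfl⟩ | ⟨τ, hτ, rfl⟩
  · exact sub_nonneg.2 (hle τ hτ)
  · exact h0 τ hτ

/-- Membership in the refined GOOD class `refT ∖ refBad` means: the core of an old good term. [folklore] -/
theorem mem_refT_sdiff_refBad [DecidableEq ι] {K : ℕ} {t : ℝ} {x : ι ⊕ ι}
    (hx : x ∈ refT T K \ refBad T Bad K t) :
    ∃ τ ∈ T K \ Bad K t, x = Sum.inl τ := by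
  rw [Finset.mem_sdiff, refT, refBad, Finset.mem_disjSum] at hx
  obtain ⟨hxT, hxB⟩ := hx
  rcases hxT with ⟨τ, hτ, rfl⟩ | ⟨τ, hτ, rfl⟩
  · refine ⟨τ, Finset.mem_sdiff.2 ⟨hτ, fun hb => hxB ?_⟩, rfl⟩
    exact Finset.inl_mem_disjSum.2 hb
  · exact absurd (Finset.inr_mem_disjSum.2 hτ) hxB

/-- **NE7b-output + NE7c-output ⇒ NE7b-output for the refined families with weights `W + Wsh`.**  The cores of the
old bad terms weigh at most the old bad terms (`sh ≥ 0`), the shells weigh at most `Wsh ·` total, and the total is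
unchanged. [folklore] -/
theorem relWeightBound_ref (hW : RelWeightBound l₀ T A B Bad W) (hSh : ShellWeightBound l₀ T A B shA shB Wsh)
    (hlt : ∀ K, W K + Wsh K < 1) :
    RelWeightBound l₀ (refT T) (refVal A shA) (refVal B shB) (refBad T Bad) (fun K => W K + Wsh K) where
  bad_subset K t ht := by
    rw [refT, refBad]
    exact Finset.disjSum_mono (hW.bad_subset K t ht) (Finset.Subset.refl _)
  nonneg K := add_nonneg (hW.nonneg K) (hSh.nonneg K)
  lt_one := hlt
  summable := hW.summable.add hSh.summable
  bad_left K t ht := by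
    rw [sum_refT_refVal, refBad, Finset.sum_disjSum]
    simp only [refVal_inl, refVal_inr]
    have h1 : ∑ τ ∈ Bad K t, (A K t τ - shA K t τ) ≤ ∑ τ ∈ Bad K t, A K t τ :=
      sum_le_sum fun τ hτ => sub_le_self _ (hSh.sh_nonneg_left K t ht τ (hW.bad_subset K t ht hτ))
    have h2 := hW.bad_left K t ht
    have h3 := hSh.left K t ht
    linarith
  bad_right K t ht := by
    rw [sum_refT_refVal, refBad, Finset.sum_disjSum]
    simp only [refVal_inl, refVal_inr]
    have h1 : ∑ τ ∈ Bad K t, (B K t τ - shB K t τ) ≤ ∑ τ ∈ Bad K t, B K t τ :=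
      sum_le_sum fun τ hτ => sub_le_self _ (hSh.sh_nonneg_right K t ht τ (hW.bad_subset K t ht hτ))
    have h2 := hW.bad_right K t ht
    have h3 := hSh.right K t ht
    linarith

/-- **The good-class sandwich of the CORE pieces is the good-class sandwich of the refined families.**  This is where
hazard G-pv07-4 is dissolved: the core pieces of the two runs carry the IDENTICAL indicator product `∏ χ^Aχ^B`, so
`T4RecentScale.density_sandwich` applies to them with `Adm := {∏ χ^Aχ^B = 1}` and `hoff` literal; the hypothesis below
is its integrated output per good term. [folklore] -/
theorem good_ref [DecidableEq ι]
    (hcore : ∀ K : ℕ, ∃ c : ℝ, ∀ t : ℝ, |t| ≤ l₀ → ∀ τ ∈ T K \ Bad K t,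
      Real.exp (c - vol * δ K) * (A K t τ - shA K t τ) ≤ B K t τ - shB K t τ ∧
        B K t τ - shB K t τ ≤ Real.exp (c + vol * δ K) * (A K t τ - shA K t τ)) :
    ∀ K : ℕ, ∃ c : ℝ, ∀ t : ℝ, |t| ≤ l₀ → ∀ x ∈ refT T K \ refBad T Bad K t,
      Real.exp (c - vol * δ K) * refVal A shA K t x ≤ refVal B shB K t x ∧
        refVal B shB K t x ≤ Real.exp (c + vol * δ K) * refVal A shA K t x := by
  intro K
  obtain ⟨c, hc⟩ := hcore K
  refine ⟨c, fun t ht x hx => ?_⟩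
  obtain ⟨τ, hτ, rfl⟩ := mem_refT_sdiff_refBad hx
  simpa only [refVal_inl] using hc t ht τ hτ

/-- **DESIGN (i) ASSEMBLED — NE7b-output + NE7c-output + core matching on the good class + summable term-wise remainders
⇒ node U6's Cauchy property with the weight slot `W + Wsh`** (CONDITIONAL kernel theorem =
`T4WeightBudget.cauchy_of_relWeightBound` for the refined families; the partition functions `Z` are the SAME as without
refinement).  Conclusions: matching modulo constants with remainders `hybridDelta vol δ (W + Wsh) K =
δ K + (−log(1 − W K − Wsh K))/vol`, their summability, the Cauchy property of every generating-function sequence on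
`|t| ≤ l₀`, and uniform convergence there.  Every estimate — `RelWeightBound` (NE7b), `ShellWeightBound` (NE7c), the
core sandwich (NE7's term-wise half on the common-refined admissible set, nodes U5b/U4′), `Summable δ` (node U4′),
positivity (cell input L1-pos) — is a hypothesis; nothing of Bałaban's is asserted. [folklore] -/
theorem cauchy_of_relWeightBound_shell [DecidableEq ι] {Z : ℕ → ℝ → ℝ} (hvol : 0 < vol) (hl₀ : 0 ≤ l₀)
    (hW : RelWeightBound l₀ T A B Bad W) (hSh : ShellWeightBound l₀ T A B shA shB Wsh)
    (hlt : ∀ K, W K + Wsh K < 1)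
    (hZA : ∀ K t, |t| ≤ l₀ → Z K t = ∑ τ ∈ T K, A K t τ)
    (hZB : ∀ K t, |t| ≤ l₀ → Z (K + 1) t = ∑ τ ∈ T K, B K t τ)
    (hpos : ∀ K t, |t| ≤ l₀ → 0 < ∑ τ ∈ T K, A K t τ) (hδ : Summable δ)
    (hcore : ∀ K : ℕ, ∃ c : ℝ, ∀ t : ℝ, |t| ≤ l₀ → ∀ τ ∈ T K \ Bad K t,
      Real.exp (c - vol * δ K) * (A K t τ - shA K t τ) ≤ B K t τ - shB K t τ ∧
        B K t τ - shB K t τ ≤ Real.exp (c + vol * δ K) * (A K t τ - shA K t τ)) :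
    MatchingModConstants vol l₀ (hybridDelta vol δ (fun K => W K + Wsh K)) Z ∧
      Summable (hybridDelta vol δ (fun K => W K + Wsh K)) ∧
      (∀ t : ℝ, |t| ≤ l₀ → CauchySeq fun K => genFun Z K t) ∧
      TendstoUniformlyOn (fun K t => genFun Z K t) (genFunLim Z) atTop {t | |t| ≤ l₀} := by
  have hZA' : ∀ K t, |t| ≤ l₀ → Z K t = ∑ x ∈ refT T K, refVal A shA K t x := fun K t ht => by
    rw [sum_refT_refVal]; exact hZA K t ht
  have hZB' : ∀ K t, |t| ≤ l₀ → Z (K + 1) t = ∑ x ∈ refT T K, refVal B shB K t x := fun K t ht => by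
    rw [sum_refT_refVal]; exact hZB K t ht
  have hA' : ∀ K t, |t| ≤ l₀ → ∀ x ∈ refT T K, 0 ≤ refVal A shA K t x := fun K t ht =>
    refVal_nonneg (hSh.sh_nonneg_left K t ht) (hSh.sh_le_left K t ht)
  have hB' : ∀ K t, |t| ≤ l₀ → ∀ x ∈ refT T K, 0 ≤ refVal B shB K t x := fun K t ht =>
    refVal_nonneg (hSh.sh_nonneg_right K t ht) (hSh.sh_le_right K t ht)
  have hpos' : ∀ K t, |t| ≤ l₀ → 0 < ∑ x ∈ refT T K, refVal A shA K t x := fun K t ht => by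
    rw [sum_refT_refVal]; exact hpos K t ht
  exact cauchy_of_relWeightBound hvol hl₀ (relWeightBound_ref hW hSh hlt) hZA' hZB' hA' hB' hpos' hδ
    (good_ref hcore)

end Plug

end Literature.MathematicalPhysics.QuantumFieldTheory.Balaban1983to89.T4IndicatorShell
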